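import Summits.KontsevichZagierPeriods.KontsevichZagierPeriods.Theorems.HurwitzMicroSectorsNormalFormPrincipleM2FiveZetaTwo

/-!
# `NormalFormPrinciple` (stmt-KontsevichZagierPeriods-3869), line `SketchIdeator1` — leaf `stub_boxRigidity`,
# dimension two off the product type (`CatalanTwoWays`, disc side): the disc split kit

Registered sub-goal `disc_split_kit` of the layer `CatalanTwoWays` (lead file `…M2`, disc side). On the
band-box `{0 < x < 1, 0 ≤ y ≤ 1}` put `a = √(2 − x²) ∈ (1, √2)`; then `a² − y² = 2 − x² − y²` and
`1/(2 − x² − y²) = 1/(2a(a + y)) + 1/(2a(a − y))` (partial fractions). We prove: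
(i) the band-box representation `[band-box, 1/(2 − x² − y²)]` exists as soon as the open-box one
does (the band-box is the open box plus the two null edges `y ∈ {0, 1}`);
(ii) `[band-box, 1/(2a(a + y))]` exists: the integrand is `ℚ`-semialgebraic (square root of a
`ℚ`-polynomial, Tarski–Seidenberg) and continuous on the compact cube `[0,1]²`, where `a ≥ 1`;
(iii) `[band-box, 1/(2a(a − y))]` exists: its integrand (unbounded at `(1,1)`) is the difference of
the two previous integrable ones on the band-box;
(iv) the three representations form ONE integrand-additivity relation (rule (1b)).
References: M. Kontsevich, D. Zagier, *Periods* (2001), §1.2. No new definitions.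
-/

noncomputable section

open MeasureTheory Set
open Literature.NumberTheory.Transcendental Literature.NumberTheory.Transcendental.KZ
open Literature.ModelTheory.ExponentialFields (IsSemialgebraic)

namespace Summit.KontsevichZagierPeriods.HurwitzMicroSectors.NormalFormPrinciple.PiBox.M2

/-! ## Elementary facts about `a = √(2 − x²)` on the band-box -/

/-- For `0 ≤ x ≤ 1` one has `1 ≤ √(2 − x²)`. [folklore] -/
private theorem one_le_sqrt_two_sub_sq {x : ℝ} (h0 : 0 ≤ x) (h1 : x ≤ 1) :
    1 ≤ Real.sqrt (2 - x ^ 2) :=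
  Real.le_sqrt_of_sq_le (by nlinarith [mul_le_mul h1 h1 h0 zero_le_one])

/-- For `0 < x < 1` one has `1 < √(2 − x²)`. [folklore] -/
private theorem one_lt_sqrt_two_sub_sq {x : ℝ} (h0 : 0 < x) (h1 : x < 1) :
    1 < Real.sqrt (2 - x ^ 2) :=
  Real.lt_sqrt_of_sq_lt (by nlinarith [mul_lt_mul'' h1 h1 h0.le h0.le])

/-- Membership in the band-box `{0 < x < 1, 0 ≤ y ≤ 1}`, unfolded. [folklore] -/
private theorem mem_bandBox {z : Fin 2 → ℝ}
    (hz : z ∈ KZlog.band {y : Fin 1 → ℝ | 0 < y 0 ∧ y 0 < 1} (fun _ => (0:ℝ)) (fun _ => (1:ℝ))) :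
    (0 < z 0 ∧ z 0 < 1) ∧ 0 ≤ z 1 ∧ z 1 ≤ 1 := hz

/-- On the band-box, with `a = √(2 − x²)`: `1 < a`, `0 < a + y`, `0 < a − y` and `a² = 2 − x²`.
[folklore] -/
private theorem disc_aux {z : Fin 2 → ℝ}
    (hz : z ∈ KZlog.band {y : Fin 1 → ℝ | 0 < y 0 ∧ y 0 < 1} (fun _ => (0:ℝ)) (fun _ => (1:ℝ))) :
    1 < Real.sqrt (2 - z 0 ^ 2) ∧ 0 < Real.sqrt (2 - z 0 ^ 2) + z 1 ∧
      0 < Real.sqrt (2 - z 0 ^ 2) - z 1 ∧ Real.sqrt (2 - z 0 ^ 2) ^ 2 = 2 - z 0 ^ 2 := by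
  have h := mem_bandBox hz
  have h1 := one_lt_sqrt_two_sub_sq h.1.1 h.1.2
  exact ⟨h1, by linarith [h.2.1], by linarith [h.2.2],
    Real.sq_sqrt (by nlinarith [mul_lt_mul'' h.1.2 h.1.2 h.1.1.le h.1.1.le])⟩

/-- **The partial-fraction split** `1/(2 − x² − y²) = 1/(2a(a + y)) + 1/(2a(a − y))`,
`a = √(2 − x²)`, at every point of the band-box (`a² − y² = (a + y)(a − y)`, all factors positive).
[cite: KontsevichZagier2001, §1.2 rule (1)] -/
private theorem disc_split_pointwise {z : Fin 2 → ℝ}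
    (hz : z ∈ KZlog.band {y : Fin 1 → ℝ | 0 < y 0 ∧ y 0 < 1} (fun _ => (0:ℝ)) (fun _ => (1:ℝ))) :
    1 / (2 - z 0 ^ 2 - z 1 ^ 2) =
      1 / (2 * Real.sqrt (2 - z 0 ^ 2) * (Real.sqrt (2 - z 0 ^ 2) + z 1)) +
        1 / (2 * Real.sqrt (2 - z 0 ^ 2) * (Real.sqrt (2 - z 0 ^ 2) - z 1)) := by
  obtain ⟨h1, hp, hm, hsq⟩ := disc_aux hz
  generalize Real.sqrt (2 - z 0 ^ 2) = a at h1 hp hm hsq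
  rw [← hsq, show a ^ 2 - z 1 ^ 2 = (a + z 1) * (a - z 1) by ring]
  have ha : a ≠ 0 := by positivity
  have hp' : a + z 1 ≠ 0 := hp.ne'
  have hm' : a - z 1 ≠ 0 := hm.ne'
  field_simp
  ring

/-! ## Semialgebraicity and integrability of the disc kernels -/

/-- `z ↦ √(2 − z₀²)` is `ℚ`-semialgebraic on the band-box (square root of a `ℚ`-polynomial;
Tarski–Seidenberg). [folklore] -/
private theorem isSemialgebraicFunOn_sqrt_two_sub_sq :
    IsSemialgebraicFunOn ℚ
      (KZlog.band {y : Fin 1 → ℝ | 0 < y 0 ∧ y 0 < 1} (fun _ => (0:ℝ)) (fun _ => (1:ℝ)))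
      (fun z => Real.sqrt (2 - z 0 ^ 2)) :=
  IsSemialgebraicFunOn.sqrt_holds ((isSemialgebraicFunOn_aeval isSemialgebraic_bandBox
    (2 - MvPolynomial.X 0 ^ 2 : MvPolynomial (Fin 2) ℚ)).congr fun z _ => by simp)

/-- If `g` is `ℚ`-semialgebraic on the band-box and `a + g` does not vanish there (`a = √(2 − x²)`),
then the kernel `1/(2a(a + g))` is `ℚ`-semialgebraic on the band-box. [folklore] -/
private theorem isSemialgebraicFunOn_discKernel {g : (Fin 2 → ℝ) → ℝ}
    (hg : IsSemialgebraicFunOn ℚ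
      (KZlog.band {y : Fin 1 → ℝ | 0 < y 0 ∧ y 0 < 1} (fun _ => (0:ℝ)) (fun _ => (1:ℝ))) g)
    (hne : ∀ z ∈ KZlog.band {y : Fin 1 → ℝ | 0 < y 0 ∧ y 0 < 1} (fun _ => (0:ℝ)) (fun _ => (1:ℝ)),
      Real.sqrt (2 - z 0 ^ 2) + g z ≠ 0) :
    IsSemialgebraicFunOn ℚ
      (KZlog.band {y : Fin 1 → ℝ | 0 < y 0 ∧ y 0 < 1} (fun _ => (0:ℝ)) (fun _ => (1:ℝ)))
      (fun z => 1 / (2 * Real.sqrt (2 - z 0 ^ 2) * (Real.sqrt (2 - z 0 ^ 2) + g z))) := by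
  have hB := isSemialgebraic_bandBox
  have hS := isSemialgebraicFunOn_sqrt_two_sub_sq
  have hden : IsSemialgebraicFunOn ℚ
      (KZlog.band {y : Fin 1 → ℝ | 0 < y 0 ∧ y 0 < 1} (fun _ => (0:ℝ)) (fun _ => (1:ℝ)))
      (fun z => 2 * Real.sqrt (2 - z 0 ^ 2) * (Real.sqrt (2 - z 0 ^ 2) + g z)) :=
    (IsSemialgebraicFunOn.mul_holds (IsSemialgebraicFunOn.mul_holds (isSemialgebraicFunOn_ratCast hB 2)
      hS) (IsSemialgebraicFunOn.add_holds hS hg)).congr fun z _ => by simp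
  refine ((isSemialgebraicFunOn_ratCast hB 1).div hden fun z hz => ?_).congr fun z _ => by simp
  exact mul_ne_zero (mul_ne_zero two_ne_zero (one_pos.trans (disc_aux hz).1).ne') (hne z hz)

/-- The kernel `1/(2a(a + y))`, `a = √(2 − x²)`, is continuous on the compact cube `[0,1]²` (where
`a ≥ 1` and `y ≥ 0`, so that its denominator is `≥ 2`), hence absolutely integrable on the band-box.
[folklore] -/
private theorem integrableOn_discPlus :
    IntegrableOn
      (fun z : Fin 2 → ℝ => 1 / (2 * Real.sqrt (2 - z 0 ^ 2) * (Real.sqrt (2 - z 0 ^ 2) + z 1)))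
      (KZlog.band {y : Fin 1 → ℝ | 0 < y 0 ∧ y 0 < 1} (fun _ => (0:ℝ)) (fun _ => (1:ℝ))) := by
  have hpos : ∀ z ∈ Set.Icc (0 : Fin 2 → ℝ) 1,
      0 < 2 * Real.sqrt (2 - z 0 ^ 2) * (Real.sqrt (2 - z 0 ^ 2) + z 1) := by
    intro z hz
    have h0 : 0 ≤ z 0 := hz.1 0
    have h0' : z 0 ≤ 1 := hz.2 0
    have h1 : 0 ≤ z 1 := hz.1 1
    have ha := one_le_sqrt_two_sub_sq h0 h0'
    exact mul_pos (mul_pos two_pos (by linarith)) (by linarith)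
  have hcont : ContinuousOn
      (fun z : Fin 2 → ℝ => 1 / (2 * Real.sqrt (2 - z 0 ^ 2) * (Real.sqrt (2 - z 0 ^ 2) + z 1)))
      (Set.Icc (0 : Fin 2 → ℝ) 1) :=
    continuousOn_const.div (by fun_prop) fun z hz => (hpos z hz).ne'
  exact (hcont.integrableOn_compact isCompact_Icc).mono_set bandBox_subset_Icc

/-! ## The kit -/

/-- **Stub (disc split kit, rules 1a/1b)** of the layer `CatalanTwoWays` (disc side), with
`a = √(2 − x²)` on the band-box `{0 < x < 1, 0 ≤ y ≤ 1}`: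
(i) from an open-box representation with integrand `1/(2 − x² − y²)`, the band-box representation
`D₀ = [band-box, 1/(2 − x² − y²)]` exists (two null edges);
(ii) `Dp = [band-box, 1/(2a(a + y))]` exists (bounded continuous semialgebraic integrand);
(iii) from any such `D₀`, `Dm = [band-box, 1/(2a(a − y))]` exists (its integrand is
`D₀`'s minus `Dp`'s on the band-box);
(iv) `[D₀] − [Dp] − [Dm]` is one integrand-additivity relation:
`1/(2 − x² − y²) = 1/(2a(a + y)) + 1/(2a(a − y))`.
[cite: KontsevichZagier2001, §1.2 rule (1)] -/
theorem disc_split_kit :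
    (∀ (N' : IntegralRep 2), N'.domain = {x | ∀ i, x i ∈ Set.Ioo (0:ℝ) 1} →
      EqOn N'.integrand (fun x => 1 / (2 - x 0 ^ 2 - x 1 ^ 2)) N'.domain →
      ∃ D₀ : IntegralRep 2,
        D₀.domain = KZlog.band {y : Fin 1 → ℝ | 0 < y 0 ∧ y 0 < 1} (fun _ => (0:ℝ)) (fun _ => (1:ℝ)) ∧
        D₀.integrand = fun z => 1 / (2 - z 0 ^ 2 - z 1 ^ 2)) ∧
    (∃ Dp : IntegralRep 2,
      Dp.domain = KZlog.band {y : Fin 1 → ℝ | 0 < y 0 ∧ y 0 < 1} (fun _ => (0:ℝ)) (fun _ => (1:ℝ)) ∧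
      Dp.integrand = fun z => 1 / (2 * Real.sqrt (2 - z 0 ^ 2) * (Real.sqrt (2 - z 0 ^ 2) + z 1))) ∧
    (∀ (D₀ : IntegralRep 2),
      D₀.domain = KZlog.band {y : Fin 1 → ℝ | 0 < y 0 ∧ y 0 < 1} (fun _ => (0:ℝ)) (fun _ => (1:ℝ)) →
      EqOn D₀.integrand (fun z => 1 / (2 - z 0 ^ 2 - z 1 ^ 2)) D₀.domain →
      ∃ Dm : IntegralRep 2,
        Dm.domain = KZlog.band {y : Fin 1 → ℝ | 0 < y 0 ∧ y 0 < 1} (fun _ => (0:ℝ)) (fun _ => (1:ℝ)) ∧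
        Dm.integrand = fun z => 1 / (2 * Real.sqrt (2 - z 0 ^ 2) * (Real.sqrt (2 - z 0 ^ 2) - z 1))) ∧
    (∀ (D₀ Dp Dm : IntegralRep 2),
      D₀.domain = KZlog.band {y : Fin 1 → ℝ | 0 < y 0 ∧ y 0 < 1} (fun _ => (0:ℝ)) (fun _ => (1:ℝ)) →
      EqOn D₀.integrand (fun z => 1 / (2 - z 0 ^ 2 - z 1 ^ 2)) D₀.domain →
      Dp.domain = KZlog.band {y : Fin 1 → ℝ | 0 < y 0 ∧ y 0 < 1} (fun _ => (0:ℝ)) (fun _ => (1:ℝ)) →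
      EqOn Dp.integrand (fun z => 1 / (2 * Real.sqrt (2 - z 0 ^ 2) * (Real.sqrt (2 - z 0 ^ 2) + z 1)))
        Dp.domain →
      Dm.domain = KZlog.band {y : Fin 1 → ℝ | 0 < y 0 ∧ y 0 < 1} (fun _ => (0:ℝ)) (fun _ => (1:ℝ)) →
      EqOn Dm.integrand (fun z => 1 / (2 * Real.sqrt (2 - z 0 ^ 2) * (Real.sqrt (2 - z 0 ^ 2) - z 1)))
        Dm.domain →
      of D₀ - of Dp - of Dm ∈ relations) := by
  have hB := isSemialgebraic_bandBox
  have hBm : MeasurableSet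
      (KZlog.band {y : Fin 1 → ℝ | 0 < y 0 ∧ y 0 < 1} (fun _ => (0:ℝ)) (fun _ => (1:ℝ))) :=
    Literature.ModelTheory.ExponentialFields.IsSemialgebraic.measurableSet_holds hB
  refine ⟨fun N' hN'd hN'i => ?_, ?_, fun D₀ hD₀d hD₀i => ?_,
    fun D₀ Dp Dm hD₀d hD₀i hDpd hDpi hDmd hDmi => ?_⟩
  · -- (i) the band-box representation `[band-box, 1/(2 − x² − y²)]`
    have hsa : IsSemialgebraicFunOn ℚ
        (KZlog.band {y : Fin 1 → ℝ | 0 < y 0 ∧ y 0 < 1} (fun _ => (0:ℝ)) (fun _ => (1:ℝ)))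
        (fun z => 1 / (2 - z 0 ^ 2 - z 1 ^ 2)) := by
      refine (isSemialgebraicFunOn_aeval_div_aeval hB 1
        (2 - MvPolynomial.X 0 ^ 2 - MvPolynomial.X 1 ^ 2) fun x hx => ?_).congr fun x _ => by simp
      have h := mem_bandBox hx
      simp only [map_sub, map_pow, map_ofNat, MvPolynomial.aeval_X]
      exact (show (0:ℝ) < 2 - x 0 ^ 2 - x 1 ^ 2 by
        nlinarith [mul_lt_mul'' h.1.2 h.1.2 h.1.1.le h.1.1.le, mul_le_mul h.2.2 h.2.2 h.2.1 zero_le_one]).ne'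
    have hint : IntegrableOn (fun z : Fin 2 → ℝ => 1 / (2 - z 0 ^ 2 - z 1 ^ 2))
        (KZlog.band {y : Fin 1 → ℝ | 0 < y 0 ∧ y 0 < 1} (fun _ => (0:ℝ)) (fun _ => (1:ℝ))) := by
      have h := N'.integrableOn.congr_fun hN'i (IntegralRep.measurableSet_domain_holds N')
      rw [hN'd] at h
      exact (h.union ((IntegrableOn.of_measure_zero
        (Measure.pi_hyperplane (fun _ => (volume : Measure ℝ)) 1 0)).union
        (IntegrableOn.of_measure_zero
          (Measure.pi_hyperplane (fun _ => (volume : Measure ℝ)) 1 1)))).mono_set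
        bandBox_subset_box_union
    exact ⟨⟨_, _, hB, hsa, hint⟩, rfl, rfl⟩
  · -- (ii) the band-box representation `[band-box, 1/(2a(a + y))]`
    have hsa := isSemialgebraicFunOn_discKernel (isSemialgebraicFunOn_apply hB 1)
      fun z hz => (disc_aux hz).2.1.ne'
    exact ⟨⟨_, _, hB, hsa, integrableOn_discPlus⟩, rfl, rfl⟩
  · -- (iii) the band-box representation `[band-box, 1/(2a(a − y))]`
    have hsa : IsSemialgebraicFunOn ℚ
        (KZlog.band {y : Fin 1 → ℝ | 0 < y 0 ∧ y 0 < 1} (fun _ => (0:ℝ)) (fun _ => (1:ℝ)))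
        (fun z => 1 / (2 * Real.sqrt (2 - z 0 ^ 2) * (Real.sqrt (2 - z 0 ^ 2) - z 1))) :=
      (isSemialgebraicFunOn_discKernel (isSemialgebraicFunOn_apply hB 1).neg fun z hz => by
        simpa [← sub_eq_add_neg] using (disc_aux hz).2.2.1.ne').congr fun z _ => by
          simp [← sub_eq_add_neg]
    have hint : IntegrableOn
        (fun z : Fin 2 → ℝ => 1 / (2 * Real.sqrt (2 - z 0 ^ 2) * (Real.sqrt (2 - z 0 ^ 2) - z 1)))
        (KZlog.band {y : Fin 1 → ℝ | 0 < y 0 ∧ y 0 < 1} (fun _ => (0:ℝ)) (fun _ => (1:ℝ))) := by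
      have h0 := D₀.integrableOn.congr_fun hD₀i (IntegralRep.measurableSet_domain_holds D₀)
      rw [hD₀d] at h0
      refine (h0.sub integrableOn_discPlus).congr_fun (fun z hz => ?_) hBm
      simp only [Pi.sub_apply]
      rw [disc_split_pointwise hz]
      ring
    exact ⟨⟨_, _, hB, hsa, hint⟩, rfl, rfl⟩
  · -- (iv) one integrand-additivity relation
    refine integrandAddRel_subset_relations ⟨2, D₀, Dp, Dm, hDpd.trans hD₀d.symm,
      hDmd.trans hD₀d.symm, fun z hz => ?_, rfl⟩
    have hzB : z ∈ KZlog.band {y : Fin 1 → ℝ | 0 < y 0 ∧ y 0 < 1} (fun _ => (0:ℝ)) (fun _ => (1:ℝ)) :=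
      hD₀d ▸ hz
    have hzp : z ∈ Dp.domain := hDpd ▸ hzB
    have hzm : z ∈ Dm.domain := hDmd ▸ hzB
    rw [Pi.add_apply, hD₀i hz, hDpi hzp, hDmi hzm]
    exact disc_split_pointwise hzB

end Summit.KontsevichZagierPeriods.HurwitzMicroSectors.NormalFormPrinciple.PiBox.M2
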